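import Mathlib.Analysis.Calculus.IteratedDeriv.Lemmas
import Mathlib.Analysis.Calculus.ContDiff.Basic
import Literature.Analysis.FunctionSpaces.TorusPeriodization
import HarnessLib

/-!
# Periodisation of functions supported in the open unit cube; time slices on a time set

Analysis/FunctionSpaces support file for the torus glue of `TorusPeriodization` (notion
`flat_torus_T3`). Two devices used to move a *planar* smooth evolution on `[0,1] × ℝ^d`,
supported in the open unit cube for each time, onto the flat torus `T^d`
(the setting of Bruè–De Lellis 2023, Thm. 4.1 / §5: "we can make both `ρ_n` and `v_n`
`1`-periodic, hence defined on the `2d`-torus"):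

* **cube-supported periodisation**: if `g` vanishes off the open cube `(0,1)^d`, its lattice
  periodisation `perSum g = ∑ₖ g(· + k)` has exactly one (possibly) non-zero term on the
  fundamental cube, `perSum g z = g z` for `z ∈ [0,1)^d` (`Torus.perSum_eq_self_of_mem_unitCube`),
  hence `perSum g y = g (repr (proj y))` and `periodize g x = g (repr x)`
  (`Torus.perSum_eq_apply_repr_proj`, `Torus.periodize_eq_apply_repr`); iterated derivatives
  commute with `perSum` (`Torus.iteratedFDeriv_perSum`), so sup norms of all derivatives of the
  periodisation are those of `g` (`Torus.norm_iteratedFDeriv_perSum_le`);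
* **time slices within a time set**: for `G` of class `C^∞` on `S ×ˢ univ` (`S ⊆ ℝ` a time set
  with unique derivatives, e.g. `Icc 0 1`), the one-sided iterated time derivatives
  `(t, y) ↦ ∂ₜᵏ|_S G(·, y)(t)` (`iteratedDerivWithin k · S`) are again `C^∞` on `S ×ˢ univ`
  (`ContDiffOn.iteratedDerivWithin_slice`), their space slices at `t ∈ S` are `C^∞`
  (`ContDiffOn.contDiff_iteratedDerivWithin_slice`), and the space derivative of a slice is a
  slice of the within-derivative (`ContDiffOn.contDiffOn_fderiv_slice_apply`).

## References

* L. Grafakos, *Classical Fourier Analysis*, 3rd ed. (2014), §3.1.1 (periodisation of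
  `C_c^∞(ℝⁿ)` functions).
* E. Bruè, C. De Lellis, Comm. Math. Phys. 400 (2023), §5, first paragraph (the use).
-/

noncomputable section

open Set Function Filter Metric
open _root_.Topology
open scoped ContDiff

namespace Literature.Analysis.FunctionSpaces

namespace Torus

variable {d : Type*} [Fintype d]
variable {F : Type*}

/-! ## Functions vanishing off the open unit cube -/

section Cube

variable [DecidableEq d]

/-- A lattice translate `z + k`, `k ≠ 0`, of a point of the fundamental cube `[0,1)^d` leaves the
open unit cube `(0,1)^d` (some coordinate is `≥ 1` or `< 0`). [folklore] -/
theorem add_latticeVec_not_mem_openCube {z : EuclideanSpace ℝ d} (hz : z ∈ unitCube d)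
    {k : d → ℤ} (hk : k ≠ 0) : ¬ ∀ i, (z + latticeVec k) i ∈ Ioo (0 : ℝ) 1 := by
  intro h
  obtain ⟨i, hi⟩ : ∃ i, k i ≠ 0 := by
    by_contra hcon
    push Not at hcon
    exact hk (funext hcon)
  have hzi := hz i
  have hki := h i
  simp only [PiLp.add_apply, latticeVec_apply, mem_Ioo] at hki
  rcases lt_or_gt_of_ne hi with hlt | hgt
  · have : (k i : ℝ) ≤ -1 := by exact_mod_cast Int.le_sub_one_iff.2 hlt
    linarith [hzi.2]
  · have : (1 : ℝ) ≤ k i := by exact_mod_cast hgt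
    linarith [hzi.1]

variable [AddCommMonoid F] [TopologicalSpace F]

/-- **One term on the fundamental cube.** If `g` vanishes off the open unit cube, then
`perSum g z = g z` for `z ∈ [0,1)^d` (all other lattice translates vanish). [folklore] -/
theorem perSum_eq_self_of_mem_unitCube {g : EuclideanSpace ℝ d → F}
    (hg : ∀ y, (¬ ∀ i, y i ∈ Ioo (0 : ℝ) 1) → g y = 0) {z : EuclideanSpace ℝ d}
    (hz : z ∈ unitCube d) : perSum g z = g z := by
  rw [perSum_apply, tsum_eq_single 0]
  · simp [latticeVec_zero]
  · intro k hk
    exact hg _ (add_latticeVec_not_mem_openCube hz hk)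

/-- If `g` vanishes off the open unit cube, `perSum g y = g (repr (proj y))`: the periodisation
is `g` read at the fundamental-cube representative. [folklore] -/
theorem perSum_eq_apply_repr_proj {g : EuclideanSpace ℝ d → F}
    (hg : ∀ y, (¬ ∀ i, y i ∈ Ioo (0 : ℝ) 1) → g y = 0) (y : EuclideanSpace ℝ d) :
    perSum g y = g (repr (proj y)) := by
  rw [← perSum_repr_proj, perSum_eq_self_of_mem_unitCube hg (repr_mem_unitCube _)]

/-- If `g` vanishes off the open unit cube, `periodize g x = g (repr x)`. [folklore] -/
theorem periodize_eq_apply_repr {g : EuclideanSpace ℝ d → F}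
    (hg : ∀ y, (¬ ∀ i, y i ∈ Ioo (0 : ℝ) 1) → g y = 0) (x : UnitAddTorus d) :
    periodize g x = g (repr x) := by
  rw [periodize_apply, perSum_eq_self_of_mem_unitCube hg (repr_mem_unitCube _)]

end Cube

section CubeSupport

variable [DecidableEq d] [Zero F]

omit [Fintype d] [DecidableEq d] in
/-- A function vanishing off the open unit cube is supported in the (half-open) unit cube.
[folklore] -/
theorem support_subset_unitCube_of_cube {g : EuclideanSpace ℝ d → F}
    (hg : ∀ y, (¬ ∀ i, y i ∈ Ioo (0 : ℝ) 1) → g y = 0) : support g ⊆ unitCube d := by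
  intro y hy
  by_contra hc
  exact hy (hg y fun h => hc fun i => Ioo_subset_Ico_self (h i))

/-- A function vanishing off the open unit cube is supported in the closed ball of radius
`card d`. [folklore] -/
theorem support_subset_closedBall_of_cube {g : EuclideanSpace ℝ d → F}
    (hg : ∀ y, (¬ ∀ i, y i ∈ Ioo (0 : ℝ) 1) → g y = 0) :
    support g ⊆ closedBall 0 (Fintype.card d) := fun _ hy =>
  mem_closedBall_zero_iff.2 (norm_le_card_of_mem_unitCube (support_subset_unitCube_of_cube hg hy))

omit [Fintype d] [DecidableEq d] in
/-- A function with topological support in the open unit cube vanishes off the open unit cube.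
[folklore] -/
theorem eq_zero_of_tsupport_subset_openCube {g : EuclideanSpace ℝ d → F}
    (hg : tsupport g ⊆ {y | ∀ i, y i ∈ Ioo (0 : ℝ) 1}) (y : EuclideanSpace ℝ d)
    (hy : ¬ ∀ i, y i ∈ Ioo (0 : ℝ) 1) : g y = 0 :=
  image_eq_zero_of_notMem_tsupport fun h => hy (hg h)

/-- A function with topological support in the open unit cube has topological support in the
closed ball of radius `card d`. [folklore] -/
theorem tsupport_subset_closedBall_of_openCube {g : EuclideanSpace ℝ d → F}
    (hg : tsupport g ⊆ {y | ∀ i, y i ∈ Ioo (0 : ℝ) 1}) :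
    tsupport g ⊆ closedBall 0 (Fintype.card d) :=
  closure_minimal (support_subset_closedBall_of_cube (eq_zero_of_tsupport_subset_openCube hg))
    isClosed_closedBall

omit [Fintype d] [DecidableEq d] in
/-- **Margin form.** If `g` vanishes at every point having a coordinate outside `[δ, 1-δ]`,
`δ > 0`, then its topological support lies in the open unit cube. [folklore] -/
theorem tsupport_subset_openCube_of_margin {g : EuclideanSpace ℝ d → F} {δ : ℝ} (hδ : 0 < δ)
    (hg : ∀ y, (∃ i, y i ∉ Icc δ (1 - δ)) → g y = 0) :
    tsupport g ⊆ {y | ∀ i, y i ∈ Ioo (0 : ℝ) 1} := by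
  have hcl : IsClosed {y : EuclideanSpace ℝ d | ∀ i, y i ∈ Icc δ (1 - δ)} := by
    have : {y : EuclideanSpace ℝ d | ∀ i, y i ∈ Icc δ (1 - δ)} =
        ⋂ i, (fun w : EuclideanSpace ℝ d => w i) ⁻¹' Icc δ (1 - δ) := by ext; simp
    rw [this]
    exact isClosed_iInter fun i => isClosed_Icc.preimage (by fun_prop)
  have hsupp : support g ⊆ {y : EuclideanSpace ℝ d | ∀ i, y i ∈ Icc δ (1 - δ)} := by
    intro y hy
    by_contra hc
    simp only [mem_setOf_eq, not_forall] at hc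
    exact hy (hg y hc)
  intro y hy i
  have h := (closure_minimal hsupp hcl hy) i
  exact ⟨lt_of_lt_of_le hδ h.1, lt_of_le_of_lt h.2 (by linarith)⟩

end CubeSupport

/-! ## Iterated derivatives of the periodisation -/

section Deriv

variable [DecidableEq d] [NormedAddCommGroup F] [NormedSpace ℝ F]

/-- **Iterated derivatives commute with periodisation**:
`Dⁿ(∑ₖ g(· + k))(y) = ∑ₖ (Dⁿg)(y + k)` for `Cⁿ` functions with bounded support (near `y` the
lattice sum is a fixed finite sum of translates; Mathlib `iteratedFDeriv_comp_add_right`).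
[folklore] -/
theorem iteratedFDeriv_perSum {n : ℕ} {g : EuclideanSpace ℝ d → F} (hgs : ContDiff ℝ n g)
    {R : ℝ} (hg : tsupport g ⊆ closedBall 0 R) (y : EuclideanSpace ℝ d) :
    iteratedFDeriv ℝ n (perSum g) y = perSum (iteratedFDeriv ℝ n g) y := by
  obtain ⟨m, hm⟩ := exists_nat_ge (R + (‖y‖ + 1))
  have hev := perSum_eventuallyEq_sum ((subset_tsupport g).trans hg) y hm
  have hd : ∀ k ∈ latticeWindow d m, ContDiffAt ℝ n (fun y => g (y + latticeVec k)) y :=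
    fun k _ => (hgs.comp (contDiff_id.add contDiff_const)).contDiffAt
  rw [(hev.iteratedFDeriv ℝ n).self_of_nhds, iteratedFDeriv_fun_sum_apply hd]
  simp_rw [iteratedFDeriv_comp_add_right]
  exact (perSum_eq_sum ((support_iteratedFDeriv_subset n).trans hg)
    (by linarith [norm_nonneg y]) hm).symm

/-- For `g ∈ Cⁿ` with topological support in the open unit cube, the `n`-th derivative of the
periodisation at `y` is the `n`-th derivative of `g` at the representative
`repr (proj y) ∈ [0,1)^d`. [folklore] -/
theorem iteratedFDeriv_perSum_eq_apply_repr {n : ℕ} {g : EuclideanSpace ℝ d → F}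
    (hgs : ContDiff ℝ n g) (hg : tsupport g ⊆ {y | ∀ i, y i ∈ Ioo (0 : ℝ) 1})
    (y : EuclideanSpace ℝ d) :
    iteratedFDeriv ℝ n (perSum g) y = iteratedFDeriv ℝ n g (repr (proj y)) := by
  rw [iteratedFDeriv_perSum hgs (tsupport_subset_closedBall_of_openCube hg) y]
  exact perSum_eq_apply_repr_proj
    (eq_zero_of_tsupport_subset_openCube ((tsupport_iteratedFDeriv_subset n).trans hg)) y

/-- **Sup norms of derivatives of the periodisation.** For `g ∈ Cⁿ` with topological support
in the open unit cube, every value `‖Dⁿ(perSum g)(y)‖` is a value `‖Dⁿ g (z)‖`, so a uniform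
bound for `Dⁿ g` is one for `Dⁿ (perSum g)`. [folklore] -/
theorem norm_iteratedFDeriv_perSum_le {n : ℕ} {g : EuclideanSpace ℝ d → F}
    (hgs : ContDiff ℝ n g) (hg : tsupport g ⊆ {y | ∀ i, y i ∈ Ioo (0 : ℝ) 1}) {C : ℝ}
    (hC : ∀ z, ‖iteratedFDeriv ℝ n g z‖ ≤ C) (y : EuclideanSpace ℝ d) :
    ‖iteratedFDeriv ℝ n (perSum g) y‖ ≤ C := by
  rw [iteratedFDeriv_perSum_eq_apply_repr hgs hg y]
  exact hC _

end Deriv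

/-! ## Time slices within a time set -/

section TimeSlice

variable {E : Type*} [NormedAddCommGroup E] [NormedSpace ℝ E]
  [NormedAddCommGroup F] [NormedSpace ℝ F]

/-- The one-sided time derivative of a time slice of a field differentiable on `S ×ˢ univ` is
its within-Fréchet derivative applied to the time direction `(1, 0)` (chain rule along the
inclusion `s ↦ (s, y)`, which maps `S` into `S ×ˢ univ`). [folklore] -/
theorem derivWithin_slice_eq_fderivWithin {G : ℝ × E → F} {S : Set ℝ}
    (hG : DifferentiableOn ℝ G (S ×ˢ univ)) {t : ℝ} (ht : t ∈ S)
    (hSt : UniqueDiffWithinAt ℝ S t) (y : E) :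
    derivWithin (fun s => G (s, y)) S t = fderivWithin ℝ G (S ×ˢ univ) (t, y) ((1 : ℝ), (0 : E)) := by
  have h1 : HasFDerivWithinAt G (fderivWithin ℝ G (S ×ˢ univ) (t, y)) (S ×ˢ univ) (t, y) :=
    (hG (t, y) ⟨ht, mem_univ _⟩).hasFDerivWithinAt
  have h2 : HasDerivWithinAt (fun s : ℝ => (s, y)) ((1 : ℝ), (0 : E)) S t :=
    (hasDerivWithinAt_id t S).prodMk (hasDerivWithinAt_const t S y)
  exact (h1.comp_hasDerivWithinAt t h2 fun s hs => mk_mem_prod hs (mem_univ _)).derivWithin hSt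

/-- **One-sided time derivatives of a smooth field are smooth.** If `G` is `C^∞` on
`S ×ˢ univ` for a time set `S` with unique derivatives, so is
`(t, y) ↦ ∂ₜ|_S G(·, y) (t)` (Mathlib `ContDiffOn.fderivWithin` on the product set, applied to
the constant direction `(1, 0)`). [folklore] -/
theorem _root_.ContDiffOn.derivWithin_slice {G : ℝ × E → F} {S : Set ℝ}
    (hG : ContDiffOn ℝ ∞ G (S ×ˢ univ)) (hS : UniqueDiffOn ℝ S) :
    ContDiffOn ℝ ∞ (fun p : ℝ × E => derivWithin (fun s => G (s, p.2)) S p.1) (S ×ˢ univ) := by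
  have hSU : UniqueDiffOn ℝ (S ×ˢ (univ : Set E)) := hS.prod uniqueDiffOn_univ
  have h1 : ContDiffOn ℝ ∞
      (fun p : ℝ × E => fderivWithin ℝ G (S ×ˢ univ) p ((1 : ℝ), (0 : E))) (S ×ˢ univ) :=
    (hG.fderivWithin hSU (by norm_cast)).clm_apply contDiffOn_const
  refine h1.congr fun p hp => ?_
  exact derivWithin_slice_eq_fderivWithin (hG.differentiableOn (by simp)) hp.1 (hS _ hp.1) p.2

/-- Iterated one-sided time derivatives `(t, y) ↦ ∂ₜᵏ|_S G(·, y) (t)` of a `C^∞` field on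
`S ×ˢ univ` are `C^∞` on `S ×ˢ univ` (induction on `k`, `iteratedDerivWithin_succ`). [folklore] -/
theorem _root_.ContDiffOn.iteratedDerivWithin_slice {G : ℝ × E → F} {S : Set ℝ}
    (hG : ContDiffOn ℝ ∞ G (S ×ˢ univ)) (hS : UniqueDiffOn ℝ S) (k : ℕ) :
    ContDiffOn ℝ ∞ (fun p : ℝ × E => iteratedDerivWithin k (fun s => G (s, p.2)) S p.1)
      (S ×ˢ univ) := by
  induction k with
  | zero => simpa using hG
  | succ k ih => simpa [iteratedDerivWithin_succ] using ih.derivWithin_slice hS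

/-- Space slices at times `t ∈ S` of a field of class `Cⁿ` on `S ×ˢ univ` are `Cⁿ`. [folklore] -/
theorem _root_.ContDiffOn.contDiff_slice {G : ℝ × E → F} {S : Set ℝ} {n : WithTop ℕ∞}
    (hG : ContDiffOn ℝ n G (S ×ˢ univ)) {t : ℝ} (ht : t ∈ S) : ContDiff ℝ n fun y => G (t, y) :=
  hG.comp_contDiff (contDiff_prodMk_right t) fun y => ⟨ht, mem_univ y⟩

/-- Space slices of the iterated one-sided time derivatives of a `C^∞` field on `S ×ˢ univ`
are `C^∞`. [folklore] -/
theorem _root_.ContDiffOn.contDiff_iteratedDerivWithin_slice {G : ℝ × E → F} {S : Set ℝ}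
    (hG : ContDiffOn ℝ ∞ G (S ×ˢ univ)) (hS : UniqueDiffOn ℝ S) (k : ℕ) {t : ℝ} (ht : t ∈ S) :
    ContDiff ℝ ∞ fun y => iteratedDerivWithin k (fun s => G (s, y)) S t :=
  (hG.iteratedDerivWithin_slice hS k).contDiff_slice ht

/-- The space derivative of a time slice of a field differentiable on `S ×ˢ univ` is its
within-Fréchet derivative composed with the space inclusion. [folklore] -/
theorem fderiv_slice_eq_fderivWithin_comp_inr {G : ℝ × E → F} {S : Set ℝ}
    (hG : DifferentiableOn ℝ G (S ×ˢ univ)) {t : ℝ} (ht : t ∈ S) (y : E) :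
    _root_.fderiv ℝ (fun z => G (t, z)) y =
      (fderivWithin ℝ G (S ×ˢ univ) (t, y)).comp (ContinuousLinearMap.inr ℝ ℝ E) := by
  have h1 : HasFDerivWithinAt G (fderivWithin ℝ G (S ×ˢ univ) (t, y)) (S ×ˢ univ) (t, y) :=
    (hG (t, y) ⟨ht, mem_univ _⟩).hasFDerivWithinAt
  have h3 : HasFDerivWithinAt (G ∘ fun z => (t, z))
      ((fderivWithin ℝ G (S ×ˢ univ) (t, y)).comp (ContinuousLinearMap.inr ℝ ℝ E)) univ y :=
    h1.comp y (hasFDerivAt_prodMk_right t y).hasFDerivWithinAt fun z _ => ⟨ht, mem_univ _⟩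
  exact (hasFDerivWithinAt_univ.1 h3).fderiv

/-- **Space derivatives of a smooth field are smooth on the time set**: for `G ∈ C^∞` on
`S ×ˢ univ`, `(t, y) ↦ D(G(t, ·))(y)` is `C^∞` on `S ×ˢ univ`. [folklore] -/
theorem _root_.ContDiffOn.contDiffOn_fderiv_slice {G : ℝ × E → F} {S : Set ℝ}
    (hG : ContDiffOn ℝ ∞ G (S ×ˢ univ)) (hS : UniqueDiffOn ℝ S) :
    ContDiffOn ℝ ∞ (fun p : ℝ × E => _root_.fderiv ℝ (fun z => G (p.1, z)) p.2) (S ×ˢ univ) := by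
  have hSU : UniqueDiffOn ℝ (S ×ˢ (univ : Set E)) := hS.prod uniqueDiffOn_univ
  have h1 : ContDiffOn ℝ ∞ (fun p : ℝ × E =>
      (fderivWithin ℝ G (S ×ˢ univ) p).comp (ContinuousLinearMap.inr ℝ ℝ E)) (S ×ˢ univ) :=
    (hG.fderivWithin hSU (by norm_cast)).clm_comp contDiffOn_const
  refine h1.congr fun p hp => ?_
  exact fderiv_slice_eq_fderivWithin_comp_inr (hG.differentiableOn (by simp)) hp.1 p.2

/-- The convective field `(t, y) ↦ D(u(t,·))(y)[u(t,y)]` of a `C^∞` field `u` on `S ×ˢ univ`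
is `C^∞` on `S ×ˢ univ`. [folklore] -/
theorem _root_.ContDiffOn.contDiffOn_convect_slice {u : ℝ × E → E} {S : Set ℝ}
    (hu : ContDiffOn ℝ ∞ u (S ×ˢ univ)) (hS : UniqueDiffOn ℝ S) :
    ContDiffOn ℝ ∞ (fun p : ℝ × E => _root_.fderiv ℝ (fun z => u (p.1, z)) p.2 (u p)) (S ×ˢ univ) :=
  (hu.contDiffOn_fderiv_slice hS).clm_apply hu

end TimeSlice

end Torus

end Literature.Analysis.FunctionSpaces

end
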